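import Mathlib.Analysis.ODE.Gronwall
import Mathlib.Analysis.SpecificLimits.Normed
import Mathlib.Analysis.SpecialFunctions.Integrals.Basic
import Mathlib.MeasureTheory.Integral.IntervalIntegral.FundThmCalculus
import Mathlib.MeasureTheory.Integral.Prod
import Mathlib.MeasureTheory.Function.StronglyMeasurable.Basic
import Mathlib.Topology.Algebra.InfiniteSum.Real
import Mathlib.Topology.UniformSpace.UniformApproximation
import HarnessLib

/-!
# Integral equations `z(t) = g(t) + ∫₀ᵗ F(z(s)) ds` with a continuous forcing (Picard iteration)

Trunk T-ANALYSIS (Literature/Analysis/ODE). The deterministic skeleton of stochastic differential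
equations with ADDITIVE noise: for a vector field `F : E → E` on a complete normed space and a
continuous forcing path `g : ℝ → E` (in the application `g(t) = z₀ + σ W(t)` for a Brownian path
`W`), the integral equation

  `z(t) = g(t) + ∫₀ᵗ F(z(s)) ds`, `t ≥ 0`,                                                    (IE)

is equivalent, for `y = z - g`, to the classical ODE `y' = F(y + g(t))`, `y(0) = 0`, and is
solved path by path — no stochastic integration is involved (e.g. Khasminskii,
*Stochastic Stability of Differential Equations*, §3.4; the reduction is folklore, sometimes called
the Doss–Sussmann trick in the additive-noise case).

Contents (all PROVED):

* `Literature.Analysis.ODE.le_mul_exp_of_le_add_mul_integral_Icc` — the integral form of Grönwall's inequality: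
  `f` continuous on `[0, T]` with `f(t) ≤ δ + K ∫₀ᵗ f` there implies `f(t) ≤ δ e^{Kt}` (the same
  statement as `Literature.Analysis.FluidPDE.le_mul_exp_of_le_add_mul_integral` of `FluidPDE/EnergyToolkit.lean`,
  kept local to avoid that import chain).
* `Literature.forcedPicard F g n` — the Picard iterates `z₀ = g`, `z_{n+1}(t) = g(t) + ∫₀ᵗ F(z_n)`, their
  continuity and the factorial estimate `‖z_{n+1}(t) - z_n(t)‖ ≤ M T (K T)ⁿ / n!` on `[0, T]` for
  `F` `K`-Lipschitz.
* `Literature.forcedSolution F g` — the limit (clamped to be constant on `(-∞, 0]`), a continuous solution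
  of (IE) on `[0, ∞)` (`forcedSolution_eq`), with the uniform error bound of the iterates.
* The predicate `Literature.IsIntegralSolutionOn F g z T` ((IE) on `[0, T]`); uniqueness among
  continuous solutions staying in a set on which `F` is Lipschitz
  (`IsIntegralSolutionOn.eqOn_of_lipschitzOnWith`), continuous dependence on the forcing
  (`IsIntegralSolutionOn.norm_sub_le_mul_exp`), and the shift identity: `z(s + ·)` solves (IE)
  with forcing `z(s) + g(s + ·) - g(s)` (`IsIntegralSolutionOn.shift`, `forcedSolution_add`), the
  flow/cocycle property behind the Markov property of the SDE.
* Measurable dependence on a parameter: if `g = G ω` depends measurably on `ω` (each `G ω`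
  continuous, each `ω ↦ G ω t` strongly measurable) then `ω ↦ forcedSolution F (G ω) t` is
  strongly measurable, jointly with `t` (`Literature.Analysis.ODE.stronglyMeasurable_forcedSolution`,
  `Literature.Analysis.ODE.stronglyMeasurable_uncurry_forcedSolution`).

## References

* E. A. Coddington, N. Levinson, *Theory of Ordinary Differential Equations* (1955), Ch. 1,
  Thm 3.1 (Picard–Lindelöf by successive approximations) and Ch. 1 §5 (Gronwall).
* R. Khasminskii, *Stochastic Stability of Differential Equations*, 2nd ed. (2012), §3.4.
-/

noncomputable section

open MeasureTheory Filter Topology Set intervalIntegral Metric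
open scoped NNReal ENNReal Nat

namespace Literature.Analysis.ODE

variable {E : Type*} [NormedAddCommGroup E] [NormedSpace ℝ E]

/-! ### Grönwall's inequality in integral form -/

/-- **Grönwall's inequality, integral form.** If `f : ℝ → ℝ` is continuous on `[0, T]` and
`f(t) ≤ δ + K ∫₀ᵗ f(s) ds` for `t ∈ [0, T]` (`K ≥ 0`), then `f(t) ≤ δ e^{Kt}` on `[0, T]`
(apply Mathlib's differential bound `le_gronwallBound_of_liminf_deriv_right_le` to the primitive
`Φ(t) = ∫₀ᵗ f`, whose right derivative is `f ≤ K Φ + δ`). This is the same statement as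
`Literature.Analysis.FluidPDE.le_mul_exp_of_le_add_mul_integral` of `Literature/Analysis/FluidPDE/EnergyToolkit.lean`
(kept local under another name to spare `Analysis/ODE` the FluidPDE import chain; cf. also the
measurable variant `Literature.Analysis.FunctionSpaces.gronwall_of_le_integral` in `FunctionSpaces/ItoProcessesProofs.lean`).
Coddington–Levinson, *Theory of ODE* (1955), Ch. 1 §5. [folklore] -/
theorem le_mul_exp_of_le_add_mul_integral_Icc {f : ℝ → ℝ} {T δ K : ℝ}
    (hf : ContinuousOn f (Icc 0 T)) (hK : 0 ≤ K)
    (h : ∀ t ∈ Icc 0 T, f t ≤ δ + K * ∫ s in (0 : ℝ)..t, f s) :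
    ∀ t ∈ Icc 0 T, f t ≤ δ * Real.exp (K * t) := by
  intro t ht
  have hT : 0 ≤ T := ht.1.trans ht.2
  set Φ : ℝ → ℝ := fun s => ∫ r in (0 : ℝ)..s, f r with hΦdef
  have hint : ∀ x ∈ Icc 0 T, IntervalIntegrable f volume 0 x := fun x hx =>
    (hf.mono (Icc_subset_Icc_right hx.2)).intervalIntegrable_of_Icc hx.1
  have hΦ_cont : ContinuousOn Φ (Icc 0 T) := by
    have h1 : ContinuousOn Φ (uIcc 0 T) :=
      intervalIntegral.continuousOn_primitive_interval
        ((hf.mono (by rw [uIcc_of_le hT])).integrableOn_compact isCompact_uIcc)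
    rwa [uIcc_of_le hT] at h1
  -- right derivative of `Φ` at `x ∈ [0, T)` is `f x`
  have hΦ_deriv : ∀ x ∈ Ico 0 T, HasDerivWithinAt Φ (f x) (Ici x) x := by
    intro x hx
    have hmem : Icc 0 T ∈ 𝓝[>] x :=
      mem_of_superset (Icc_mem_nhdsGT hx.2) (Icc_subset_Icc_left hx.1)
    have hle : 𝓝[>] x ≤ 𝓝[Icc 0 T] x := nhdsWithin_le_iff.2 hmem
    exact intervalIntegral.integral_hasDerivWithinAt_right (hint x ⟨hx.1, hx.2.le⟩)
      ((hf.stronglyMeasurableAtFilter_nhdsWithin measurableSet_Icc x).filter_mono hle)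
      ((hf x ⟨hx.1, hx.2.le⟩).mono_of_mem_nhdsWithin hmem)
  have hG : ∀ x ∈ Icc (0 : ℝ) T, Φ x ≤ gronwallBound 0 K δ (x - 0) := by
    refine le_gronwallBound_of_liminf_deriv_right_le (f' := f) hΦ_cont (fun x hx r hr => ?_)
      (by simp [hΦdef]) fun x hx => ?_
    · have := (hΦ_deriv x hx).liminf_right_slope_le hr
      refine this.mono fun z hz => ?_
      rwa [slope_def_field, div_eq_inv_mul] at hz
    · have h' := h x ⟨hx.1, hx.2.le⟩
      change f x ≤ δ + K * Φ x at h'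
      linarith
  have hGt := hG t ht
  rw [sub_zero] at hGt
  rcases hK.eq_or_lt with hK0 | hKpos
  · have := h t ht
    rw [← hK0] at this ⊢
    simpa using this
  · rw [gronwallBound_of_K_ne_0 hKpos.ne'] at hGt
    simp only [zero_mul, zero_add] at hGt
    have h2 : K * Φ t ≤ δ * (Real.exp (K * t) - 1) := by
      calc K * Φ t ≤ K * (δ / K * (Real.exp (K * t) - 1)) := mul_le_mul_of_nonneg_left hGt hKpos.le
        _ = δ * (Real.exp (K * t) - 1) := by field_simp
    have h1 : f t ≤ δ + K * Φ t := h t ht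
    calc f t ≤ δ + K * Φ t := h1
      _ ≤ δ + δ * (Real.exp (K * t) - 1) := by linarith
      _ = δ * Real.exp (K * t) := by ring

/-! ### Picard iterates -/

/-- The **Picard iterates** of the integral equation `z(t) = g(t) + ∫₀ᵗ F(z(s)) ds`:
`z₀ = g`, `z_{n+1}(t) = g(t) + ∫₀ᵗ F(z_n(s)) ds`.
Coddington–Levinson, *Theory of ODE* (1955), Ch. 1, Thm 3.1. [folklore] -/
def forcedPicard (F : E → E) (g : ℝ → E) : ℕ → ℝ → E
  | 0 => g
  | n + 1 => fun t => g t + ∫ s in (0 : ℝ)..t, F (forcedPicard F g n s)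

section Picard

variable {F : E → E} {g : ℝ → E}

/-- `z₀ = g`. [folklore] -/
@[simp] theorem forcedPicard_zero (F : E → E) (g : ℝ → E) : forcedPicard F g 0 = g := rfl

/-- `z_{n+1}(t) = g(t) + ∫₀ᵗ F(z_n(s)) ds`. [folklore] -/
theorem forcedPicard_succ (F : E → E) (g : ℝ → E) (n : ℕ) (t : ℝ) :
    forcedPicard F g (n + 1) t = g t + ∫ s in (0 : ℝ)..t, F (forcedPicard F g n s) := rfl

/-- The Picard iterates of a continuous forcing are continuous (for continuous `F`). [folklore] -/
theorem continuous_forcedPicard (hF : Continuous F) (hg : Continuous g) : ∀ n, Continuous (forcedPicard F g n)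
  | 0 => hg
  | n + 1 => by
    have ih := continuous_forcedPicard hF hg n
    exact hg.add (intervalIntegral.continuous_primitive
      (fun a b => ((hF.comp ih).intervalIntegrable a b)) 0)

/-- The Picard iterates at time `t ≥ 0` only depend on the forcing on `[0, t]`. [folklore] -/
theorem forcedPicard_congr {g₁ g₂ : ℝ → E} {T : ℝ} (h : EqOn g₁ g₂ (Icc 0 T)) :
    ∀ n, EqOn (forcedPicard F g₁ n) (forcedPicard F g₂ n) (Icc 0 T)
  | 0 => h
  | n + 1 => by
    intro t ht
    rw [forcedPicard_succ, forcedPicard_succ, h ht]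
    congr 1
    refine intervalIntegral.integral_congr fun s hs => ?_
    rw [uIcc_of_le ht.1] at hs
    rw [forcedPicard_congr h n ⟨hs.1, hs.2.trans ht.2⟩]

variable {K : ℝ≥0}

/-- **The factorial estimate for the Picard increments**: if `F` is `K`-Lipschitz and
`‖F(g(s))‖ ≤ M` on `[0, T]`, then `‖z_{n+1}(t) - z_n(t)‖ ≤ M Kⁿ t^{n+1} / (n+1)!` for
`t ∈ [0, T]`. Coddington–Levinson, *Theory of ODE* (1955), Ch. 1, proof of Thm 3.1. [folklore] -/
theorem norm_forcedPicard_succ_sub_le (hF : LipschitzWith K F) (hg : Continuous g) {T M : ℝ}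
    (hM : ∀ s ∈ Icc 0 T, ‖F (g s)‖ ≤ M) :
    ∀ n, ∀ t ∈ Icc 0 T, ‖forcedPicard F g (n + 1) t - forcedPicard F g n t‖ ≤
      M * ((K : ℝ) ^ n * t ^ (n + 1) / (n + 1)!) := by
  have hFc : Continuous F := hF.continuous
  intro n
  induction n with
  | zero =>
    intro t ht
    rw [forcedPicard_succ, forcedPicard_zero, add_sub_cancel_left]
    have h1 : ‖∫ s in (0 : ℝ)..t, F (g s)‖ ≤ M * |t - 0| :=
      intervalIntegral.norm_integral_le_of_norm_le_const fun s hs => by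
        rw [uIoc_of_le ht.1] at hs
        exact hM s ⟨hs.1.le, hs.2.trans ht.2⟩
    simpa [abs_of_nonneg ht.1] using h1
  | succ n ih =>
    intro t ht
    have hc1 := continuous_forcedPicard hFc hg (n + 1)
    have hc0 := continuous_forcedPicard hFc hg n
    have hi1 : IntervalIntegrable (fun s => F (forcedPicard F g (n + 1) s)) volume 0 t :=
      (hFc.comp hc1).intervalIntegrable _ _
    have hi0 : IntervalIntegrable (fun s => F (forcedPicard F g n s)) volume 0 t :=
      (hFc.comp hc0).intervalIntegrable _ _
    have hsub : forcedPicard F g (n + 2) t - forcedPicard F g (n + 1) t =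
        ∫ s in (0 : ℝ)..t, (F (forcedPicard F g (n + 1) s) - F (forcedPicard F g n s)) := by
      rw [forcedPicard_succ, forcedPicard_succ, intervalIntegral.integral_sub hi1 hi0]
      abel
    rw [hsub]
    have hbound : ∀ s ∈ Icc 0 t, ‖F (forcedPicard F g (n + 1) s) - F (forcedPicard F g n s)‖ ≤
        K * (M * ((K : ℝ) ^ n * s ^ (n + 1) / (n + 1)!)) := by
      intro s hs
      calc ‖F (forcedPicard F g (n + 1) s) - F (forcedPicard F g n s)‖
          ≤ K * ‖forcedPicard F g (n + 1) s - forcedPicard F g n s‖ := by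
            rw [← dist_eq_norm, ← dist_eq_norm]; exact hF.dist_le_mul _ _
        _ ≤ K * (M * ((K : ℝ) ^ n * s ^ (n + 1) / (n + 1)!)) :=
            mul_le_mul_of_nonneg_left (ih s ⟨hs.1, hs.2.trans ht.2⟩) K.coe_nonneg
    calc ‖∫ s in (0 : ℝ)..t, (F (forcedPicard F g (n + 1) s) - F (forcedPicard F g n s))‖
        ≤ ∫ s in (0 : ℝ)..t, K * (M * ((K : ℝ) ^ n * s ^ (n + 1) / (n + 1)!)) :=
          intervalIntegral.norm_integral_le_of_norm_le ht.1
            (Eventually.of_forall fun s hs => hbound s ⟨hs.1.le, hs.2⟩)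
            ((by fun_prop : Continuous fun s : ℝ =>
              (K : ℝ) * (M * ((K : ℝ) ^ n * s ^ (n + 1) / (n + 1)!))).intervalIntegrable _ _)
      _ = M * ((K : ℝ) ^ (n + 1) * t ^ (n + 1 + 1) / (n + 1 + 1)!) := by
          have hi : ∫ s in (0 : ℝ)..t, K * (M * ((K : ℝ) ^ n * s ^ (n + 1) / (n + 1)!)) =
              K * M * (K : ℝ) ^ n / (n + 1)! * ∫ s in (0 : ℝ)..t, s ^ (n + 1) := by
            rw [← intervalIntegral.integral_const_mul]
            refine intervalIntegral.integral_congr fun s _ => ?_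
            ring
          rw [hi, integral_pow]
          simp only [ne_eq, Nat.add_eq_zero_iff, one_ne_zero, and_false, not_false_eq_true, zero_pow,
            sub_zero, Nat.factorial_succ]
          push_cast
          have h1 : ((n : ℝ) + 1) ≠ 0 := by positivity
          have h2 : ((n : ℝ) + 1 + 1) ≠ 0 := by positivity
          have h3 : ((n + 1)! : ℝ) ≠ 0 := by positivity
          field_simp
          ring

/-- The increments on `[0, T]` are bounded by the terms of a convergent exponential series:
`‖z_{n+1}(t) - z_n(t)‖ ≤ M T (K T)ⁿ / n!` (`M ≥ 0`). [folklore] -/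
theorem norm_forcedPicard_succ_sub_le' (hF : LipschitzWith K F) (hg : Continuous g) {T M : ℝ}
    (hM0 : 0 ≤ M) (hM : ∀ s ∈ Icc 0 T, ‖F (g s)‖ ≤ M) (n : ℕ) {t : ℝ} (ht : t ∈ Icc 0 T) :
    ‖forcedPicard F g (n + 1) t - forcedPicard F g n t‖ ≤ M * T * (((K : ℝ) * T) ^ n / n !) := by
  refine (norm_forcedPicard_succ_sub_le hF hg hM n t ht).trans ?_
  have hT : 0 ≤ T := ht.1.trans ht.2
  have hKn : 0 ≤ (K : ℝ) ^ n := pow_nonneg K.coe_nonneg n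
  have h1 : t ^ (n + 1) ≤ T ^ (n + 1) := pow_le_pow_left₀ ht.1 ht.2 _
  have h2 : ((n !) : ℝ) ≤ (n + 1)! := by exact_mod_cast Nat.factorial_le (Nat.le_succ n)
  have hfpos : (0 : ℝ) < n ! := by positivity
  calc M * ((K : ℝ) ^ n * t ^ (n + 1) / (n + 1)!)
      ≤ M * ((K : ℝ) ^ n * T ^ (n + 1) / n !) := by
        refine mul_le_mul_of_nonneg_left ?_ hM0
        refine div_le_div₀ (by positivity) (mul_le_mul_of_nonneg_left h1 hKn) hfpos h2
    _ = M * T * (((K : ℝ) * T) ^ n / n !) := by ring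

omit [NormedSpace ℝ E] in
/-- A bound `M ≥ 0` for `‖F∘g‖` on `[0, T]` exists (continuity on a compact interval). [folklore] -/
theorem exists_bound_comp_forcing (hF : Continuous F) (hg : Continuous g) (T : ℝ) :
    ∃ M, 0 ≤ M ∧ ∀ s ∈ Icc 0 T, ‖F (g s)‖ ≤ M := by
  obtain ⟨M, hM⟩ := isCompact_Icc.exists_bound_of_continuousOn
    ((hF.comp hg).continuousOn (s := Icc 0 T))
  exact ⟨max M 0, le_max_right _ _, fun s hs => (hM s hs).trans (le_max_left _ _)⟩

/-- The exponential series `M T (K T)ⁿ / n!` bounding the Picard increments on `[0, T]`.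
[folklore] -/
def forcedPicardBound (K : ℝ≥0) (M T : ℝ) (n : ℕ) : ℝ := M * T * (((K : ℝ) * T) ^ n / n !)

/-- The bounding series is summable (exponential series). [folklore] -/
theorem summable_forcedPicardBound (K : ℝ≥0) (M T : ℝ) : Summable (forcedPicardBound K M T) :=
  (Real.summable_pow_div_factorial ((K : ℝ) * T)).mul_left (M * T)

/-- At each time `t ≥ 0` the Picard iterates form a Cauchy sequence. [folklore] -/
theorem cauchySeq_forcedPicard (hF : LipschitzWith K F) (hg : Continuous g) {t : ℝ} (ht : 0 ≤ t) :
    CauchySeq fun n => forcedPicard F g n t := by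
  obtain ⟨M, hM0, hM⟩ := exists_bound_comp_forcing hF.continuous hg t
  refine cauchySeq_of_dist_le_of_summable (forcedPicardBound K M t) (fun n => ?_) (summable_forcedPicardBound K M t)
  rw [dist_comm, dist_eq_norm]
  exact norm_forcedPicard_succ_sub_le' hF hg hM0 hM n ⟨ht, le_rfl⟩

end Picard

/-! ### The solution -/

/-- The **solution of the integral equation** `z(t) = g(t) + ∫₀ᵗ F(z(s)) ds` obtained as the limit
of the Picard iterates, for `t ≥ 0`; for `t ≤ 0` it is clamped to its value at `0` (`= g 0`), so
that it is a continuous function on `ℝ`. Meaningful (and characterised by `forcedSolution_eq`) when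
`F` is Lipschitz and `g` continuous; otherwise a junk limit.
Coddington–Levinson, *Theory of ODE* (1955), Ch. 1, Thm 3.1. [folklore] -/
def forcedSolution [CompleteSpace E] (F : E → E) (g : ℝ → E) (t : ℝ) : E :=
  limUnder atTop fun n => forcedPicard F g n (max t 0)

section Solution

variable [CompleteSpace E] {K : ℝ≥0} {F : E → E} {g : ℝ → E}

/-- The solution is clamped: `z(t) = z(max(t, 0))`. [folklore] -/
theorem forcedSolution_eq_max (F : E → E) (g : ℝ → E) (t : ℝ) :
    forcedSolution F g t = forcedSolution F g (max t 0) := by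
  simp [forcedSolution]

/-- For `t ≤ 0`, `z(t) = z(0)`. [folklore] -/
theorem forcedSolution_of_nonpos (F : E → E) (g : ℝ → E) {t : ℝ} (ht : t ≤ 0) :
    forcedSolution F g t = forcedSolution F g 0 := by
  rw [forcedSolution_eq_max, max_eq_right ht, forcedSolution_eq_max F g 0, max_self]

/-- **Convergence of the Picard iterates** to the solution at every `t ≥ 0`. [folklore] -/
theorem tendsto_forcedPicard (hF : LipschitzWith K F) (hg : Continuous g) {t : ℝ} (ht : 0 ≤ t) :
    Tendsto (fun n => forcedPicard F g n t) atTop (𝓝 (forcedSolution F g t)) := by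
  have h := tendsto_nhds_limUnder (cauchySeq_tendsto_of_complete (cauchySeq_forcedPicard hF hg ht))
  simpa [forcedSolution, max_eq_left ht] using h

/-- **Uniform error bound** on `[0, T]`: `‖z_n(t) - z(t)‖ ≤ ∑_{m ≥ n} M T (K T)ᵐ / m!`, a tail
tending to `0` (`tendsto_forcedPicardTail`). [folklore] -/
theorem norm_forcedPicard_sub_forcedSolution_le (hF : LipschitzWith K F) (hg : Continuous g) {T M : ℝ}
    (hM0 : 0 ≤ M) (hM : ∀ s ∈ Icc 0 T, ‖F (g s)‖ ≤ M) (n : ℕ) {t : ℝ} (ht : t ∈ Icc 0 T) :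
    ‖forcedPicard F g n t - forcedSolution F g t‖ ≤
      ∑' m, M * T * (((K : ℝ) * T) ^ (n + m) / (n + m)!) := by
  rw [← dist_eq_norm]
  exact dist_le_tsum_of_dist_le_of_tendsto (forcedPicardBound K M T)
    (fun k => by rw [dist_comm, dist_eq_norm]; exact norm_forcedPicard_succ_sub_le' hF hg hM0 hM k ht)
    (summable_forcedPicardBound K M T) (tendsto_forcedPicard hF hg ht.1) n

/-- The tails `∑_{m ≥ n} M T (K T)ᵐ / m!` tend to `0`. [folklore] -/
theorem tendsto_forcedPicardTail (K : ℝ≥0) (M T : ℝ) :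
    Tendsto (fun n : ℕ => ∑' m, M * T * (((K : ℝ) * T) ^ (n + m) / (n + m)!)) atTop (𝓝 0) := by
  have h := tendsto_sum_nat_add (forcedPicardBound K M T)
  refine h.congr fun n => ?_
  exact tsum_congr fun m => by simp [forcedPicardBound, add_comm]

/-- The Picard iterates converge to the solution **uniformly on `[0, T]`**. [folklore] -/
theorem tendstoUniformlyOn_forcedPicard (hF : LipschitzWith K F) (hg : Continuous g) (T : ℝ) :
    TendstoUniformlyOn (fun n => forcedPicard F g n) (forcedSolution F g) atTop (Icc 0 T) := by
  obtain ⟨M, hM0, hM⟩ := exists_bound_comp_forcing hF.continuous hg T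
  rw [Metric.tendstoUniformlyOn_iff]
  intro ε hε
  filter_upwards [(tendsto_forcedPicardTail K M T).eventually (gt_mem_nhds hε)] with n hn t ht
  rw [dist_comm, dist_eq_norm]
  exact (norm_forcedPicard_sub_forcedSolution_le hF hg hM0 hM n ht).trans_lt hn

/-- **The solution is continuous** (on all of `ℝ`, being clamped on `(-∞, 0]`). [folklore] -/
theorem continuous_forcedSolution (hF : LipschitzWith K F) (hg : Continuous g) :
    Continuous (forcedSolution F g) := by
  have hIcc : ∀ T, ContinuousOn (forcedSolution F g) (Icc 0 T) := fun T =>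
    (tendstoUniformlyOn_forcedPicard hF hg T).continuousOn
      (Eventually.of_forall fun n => (continuous_forcedPicard hF.continuous hg n).continuousOn).frequently
  have hIci : ContinuousOn (forcedSolution F g) (Ici 0) := by
    intro t ht
    have h1 : ContinuousWithinAt (forcedSolution F g) (Icc 0 (t + 1)) t :=
      hIcc (t + 1) t ⟨ht, by linarith⟩
    refine h1.mono_of_mem_nhdsWithin (Filter.mem_of_superset
      (inter_mem_nhdsWithin (Ici (0 : ℝ)) (Iio_mem_nhds (by linarith : t < t + 1))) ?_)
    rintro s ⟨hs0, hs1⟩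
    exact ⟨hs0, (le_of_lt hs1)⟩
  have heq : forcedSolution F g = (forcedSolution F g) ∘ fun t => max t 0 :=
    funext fun t => forcedSolution_eq_max F g t
  rw [heq]
  exact hIci.comp_continuous (continuous_id.max continuous_const) fun t => Set.mem_Ici.2 (le_max_right _ _)

/-- **The limit solves the integral equation**: `z(t) = g(t) + ∫₀ᵗ F(z(s)) ds` for `t ≥ 0`
(pass to the limit in `z_{n+1}(t) = g(t) + ∫₀ᵗ F(z_n)` using the uniform error bound).
Coddington–Levinson, *Theory of ODE* (1955), Ch. 1, Thm 3.1. [folklore] -/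
theorem forcedSolution_eq (hF : LipschitzWith K F) (hg : Continuous g) {t : ℝ} (ht : 0 ≤ t) :
    forcedSolution F g t = g t + ∫ s in (0 : ℝ)..t, F (forcedSolution F g s) := by
  obtain ⟨M, hM0, hM⟩ := exists_bound_comp_forcing hF.continuous hg t
  have hFc := hF.continuous
  have hzc := continuous_forcedSolution hF hg
  set tail : ℕ → ℝ := fun n => ∑' m, M * t * (((K : ℝ) * t) ^ (n + m) / (n + m)!) with htail
  have h1 : Tendsto (fun n => forcedPicard F g (n + 1) t) atTop (𝓝 (forcedSolution F g t)) :=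
    (tendsto_forcedPicard hF hg ht).comp (tendsto_add_atTop_nat 1)
  have h2 : Tendsto (fun n => forcedPicard F g (n + 1) t) atTop
      (𝓝 (g t + ∫ s in (0 : ℝ)..t, F (forcedSolution F g s))) := by
    simp only [forcedPicard_succ]
    refine tendsto_const_nhds.add ?_
    rw [tendsto_iff_norm_sub_tendsto_zero]
    have hi' : IntervalIntegrable (fun s => F (forcedSolution F g s)) volume 0 t :=
      (hFc.comp hzc).intervalIntegrable _ _
    have hi : ∀ n, IntervalIntegrable (fun s => F (forcedPicard F g n s)) volume 0 t := fun n =>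
      (hFc.comp (continuous_forcedPicard hFc hg n)).intervalIntegrable _ _
    have hbound : ∀ n, ‖(∫ s in (0 : ℝ)..t, F (forcedPicard F g n s)) -
        ∫ s in (0 : ℝ)..t, F (forcedSolution F g s)‖ ≤ K * tail n * |t - 0| := by
      intro n
      rw [← intervalIntegral.integral_sub (hi n) hi']
      refine intervalIntegral.norm_integral_le_of_norm_le_const fun s hs => ?_
      rw [uIoc_of_le ht] at hs
      calc ‖F (forcedPicard F g n s) - F (forcedSolution F g s)‖
          ≤ K * ‖forcedPicard F g n s - forcedSolution F g s‖ := by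
            rw [← dist_eq_norm, ← dist_eq_norm]; exact hF.dist_le_mul _ _
        _ ≤ K * tail n := mul_le_mul_of_nonneg_left
            (norm_forcedPicard_sub_forcedSolution_le hF hg hM0 hM n ⟨hs.1.le, hs.2⟩) K.coe_nonneg
    refine squeeze_zero (fun n => norm_nonneg _) hbound ?_
    have : Tendsto (fun n => (K : ℝ) * tail n * |t - 0|) atTop (𝓝 ((K : ℝ) * 0 * |t - 0|)) :=
      ((tendsto_forcedPicardTail K M t).const_mul _).mul_const _
    simpa using this
  exact tendsto_nhds_unique h1 h2

/-- `z(0) = g(0)`. [folklore] -/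
theorem forcedSolution_zero (hF : LipschitzWith K F) (hg : Continuous g) :
    forcedSolution F g 0 = g 0 := by
  simpa using forcedSolution_eq hF hg le_rfl

/-- The solution on `[0, T]` only depends on the forcing on `[0, T]`. [folklore] -/
theorem forcedSolution_congr (hF : LipschitzWith K F) {g₁ g₂ : ℝ → E} (hg₁ : Continuous g₁)
    (hg₂ : Continuous g₂) {T : ℝ} (h : EqOn g₁ g₂ (Icc 0 T)) :
    EqOn (forcedSolution F g₁) (forcedSolution F g₂) (Icc 0 T) := fun _ ht =>
  tendsto_nhds_unique (tendsto_forcedPicard hF hg₁ ht.1)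
    ((tendsto_forcedPicard hF hg₂ ht.1).congr fun n => (forcedPicard_congr h n ht).symm)

end Solution

/-! ### Solutions of the integral equation: uniqueness, stability, shift -/

/-- `IsIntegralSolutionOn F g z T`: `z(t) = g(t) + ∫₀ᵗ F(z(s)) ds` for all `t ∈ [0, T]`.
[folklore] -/
def IsIntegralSolutionOn (F : E → E) (g z : ℝ → E) (T : ℝ) : Prop :=
  ∀ t ∈ Icc 0 T, z t = g t + ∫ s in (0 : ℝ)..t, F (z s)

namespace IsIntegralSolutionOn

variable {F : E → E} {K : ℝ≥0} {S : Set E}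

/-- Restriction to a shorter interval. [folklore] -/
theorem mono {g z : ℝ → E} {T T' : ℝ} (h : IsIntegralSolutionOn F g z T) (hT : T' ≤ T) :
    IsIntegralSolutionOn F g z T' := fun t ht => h t ⟨ht.1, ht.2.trans hT⟩

/-- At `t = 0` a solution equals the forcing (if `0 ≤ T`). [folklore] -/
theorem apply_zero {g z : ℝ → E} {T : ℝ} (h : IsIntegralSolutionOn F g z T) (hT : 0 ≤ T) :
    z 0 = g 0 := by
  simpa using h 0 ⟨le_rfl, hT⟩

/-- **Continuous dependence on the forcing (Gronwall).** Two continuous solutions with forcings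
`g₁, g₂`, staying on `[0, T]` in a set on which `F` is `K`-Lipschitz, satisfy
`‖z₁(t) - z₂(t)‖ ≤ (sup_{[0,T]} ‖g₁ - g₂‖) e^{Kt}`.
Coddington–Levinson, *Theory of ODE* (1955), Ch. 1, Thm 2.1 / §5. [folklore] -/
theorem norm_sub_le_mul_exp (hF : LipschitzOnWith K F S) {g₁ g₂ z₁ z₂ : ℝ → E} {T δ : ℝ}
    (h₁ : IsIntegralSolutionOn F g₁ z₁ T) (h₂ : IsIntegralSolutionOn F g₂ z₂ T)
    (hc₁ : Continuous z₁) (hc₂ : Continuous z₂) (hS₁ : ∀ t ∈ Icc 0 T, z₁ t ∈ S)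
    (hS₂ : ∀ t ∈ Icc 0 T, z₂ t ∈ S) (hδ : ∀ t ∈ Icc 0 T, ‖g₁ t - g₂ t‖ ≤ δ) :
    ∀ t ∈ Icc 0 T, ‖z₁ t - z₂ t‖ ≤ δ * Real.exp (K * t) := by
  have hFc : ContinuousOn F S := hF.continuousOn
  have hco : ∀ {z : ℝ → E}, Continuous z → (∀ t ∈ Icc 0 T, z t ∈ S) →
      ContinuousOn (fun s => F (z s)) (Icc 0 T) := fun hz hS =>
    hFc.comp hz.continuousOn hS
  refine le_mul_exp_of_le_add_mul_integral_Icc (f := fun t => ‖z₁ t - z₂ t‖)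
    (hc₁.sub hc₂).norm.continuousOn K.coe_nonneg fun t ht => ?_
  have hsub : Icc 0 t ⊆ Icc 0 T := Icc_subset_Icc_right ht.2
  have hi₁ : IntervalIntegrable (fun s => F (z₁ s)) volume 0 t :=
    ((hco hc₁ hS₁).mono hsub).intervalIntegrable_of_Icc ht.1
  have hi₂ : IntervalIntegrable (fun s => F (z₂ s)) volume 0 t :=
    ((hco hc₂ hS₂).mono hsub).intervalIntegrable_of_Icc ht.1
  have heq : z₁ t - z₂ t = (g₁ t - g₂ t) + ∫ s in (0 : ℝ)..t, (F (z₁ s) - F (z₂ s)) := by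
    rw [intervalIntegral.integral_sub hi₁ hi₂, h₁ t ht, h₂ t ht]
    abel
  rw [heq]
  calc ‖(g₁ t - g₂ t) + ∫ s in (0 : ℝ)..t, (F (z₁ s) - F (z₂ s))‖
      ≤ ‖g₁ t - g₂ t‖ + ‖∫ s in (0 : ℝ)..t, (F (z₁ s) - F (z₂ s))‖ := norm_add_le _ _
    _ ≤ δ + ∫ s in (0 : ℝ)..t, K * ‖z₁ s - z₂ s‖ := by
        refine add_le_add (hδ t ht) ?_
        refine intervalIntegral.norm_integral_le_of_norm_le ht.1
          (Eventually.of_forall fun s hs => ?_) ?_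
        · have hs' : s ∈ Icc 0 T := ⟨hs.1.le, hs.2.trans ht.2⟩
          exact hF.norm_sub_le (hS₁ s hs') (hS₂ s hs')
        · exact ((hc₁.sub hc₂).norm.const_mul (K : ℝ)).intervalIntegrable _ _
    _ = δ + K * ∫ s in (0 : ℝ)..t, ‖z₁ s - z₂ s‖ := by
        rw [intervalIntegral.integral_const_mul]

/-- **Uniqueness**: two continuous solutions with the same forcing, staying on `[0, T]` in a set on
which `F` is Lipschitz, coincide on `[0, T]`.
Coddington–Levinson, *Theory of ODE* (1955), Ch. 1, Thm 2.2. [folklore] -/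
theorem eqOn_of_lipschitzOnWith (hF : LipschitzOnWith K F S) {g z₁ z₂ : ℝ → E} {T : ℝ}
    (h₁ : IsIntegralSolutionOn F g z₁ T) (h₂ : IsIntegralSolutionOn F g z₂ T)
    (hc₁ : Continuous z₁) (hc₂ : Continuous z₂) (hS₁ : ∀ t ∈ Icc 0 T, z₁ t ∈ S)
    (hS₂ : ∀ t ∈ Icc 0 T, z₂ t ∈ S) : EqOn z₁ z₂ (Icc 0 T) := by
  intro t ht
  have h := norm_sub_le_mul_exp hF h₁ h₂ hc₁ hc₂ hS₁ hS₂ (δ := 0) (fun s _ => by simp) t ht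
  rw [zero_mul, norm_le_zero_iff, sub_eq_zero] at h
  exact h

/-- **The shift identity (flow property).** If `z` solves the equation with forcing `g` on
`[0, T]` and `F∘z` is continuous on `[0, T]`, then for `s ∈ [0, T]` the shifted path
`t ↦ z(s + t)` solves it on `[0, T - s]` with the shifted forcing `t ↦ z(s) + (g(s+t) - g(s))`:
`z(s+t) = z(s) + (g(s+t) - g(s)) + ∫₀ᵗ F(z(s+r)) dr`. [folklore] -/
theorem shift {g z : ℝ → E} {T : ℝ} (h : IsIntegralSolutionOn F g z T)
    (hFz : ContinuousOn (fun r => F (z r)) (Icc 0 T)) {s : ℝ} (hs : s ∈ Icc 0 T) :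
    IsIntegralSolutionOn F (fun t => z s + (g (s + t) - g s)) (fun t => z (s + t)) (T - s) := by
  intro t ht
  have hst : s + t ∈ Icc 0 T := ⟨add_nonneg hs.1 ht.1, by linarith [ht.2]⟩
  have hi1 : IntervalIntegrable (fun r => F (z r)) volume 0 s :=
    (hFz.mono (Icc_subset_Icc_right hs.2)).intervalIntegrable_of_Icc hs.1
  have hi2 : IntervalIntegrable (fun r => F (z r)) volume s (s + t) :=
    (hFz.mono (Icc_subset_Icc hs.1 hst.2)).intervalIntegrable_of_Icc (by linarith [ht.1])
  have h1 := h (s + t) hst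
  rw [← intervalIntegral.integral_add_adjacent_intervals hi1 hi2] at h1
  have h0 := h s hs
  have hsh : ∫ r in (0 : ℝ)..t, F (z (s + r)) = ∫ r in s..(s + t), F (z r) := by
    rw [intervalIntegral.integral_comp_add_left (fun r => F (z r)) s, add_zero]
  show z (s + t) = z s + (g (s + t) - g s) + ∫ r in (0 : ℝ)..t, F (z (s + r))
  rw [hsh, h1, h0]
  abel

end IsIntegralSolutionOn

section SolutionProps

variable [CompleteSpace E] {K : ℝ≥0} {F : E → E} {g : ℝ → E}

/-- The Picard solution solves the equation on every `[0, T]`. [folklore] -/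
theorem isIntegralSolutionOn_forcedSolution (hF : LipschitzWith K F) (hg : Continuous g) (T : ℝ) :
    IsIntegralSolutionOn F g (forcedSolution F g) T := fun _ ht =>
  forcedSolution_eq hF hg ht.1

/-- **Uniqueness for the Picard solution**: any continuous solution on `[0, T]` (global Lipschitz
`F`) is the Picard solution there. [folklore] -/
theorem IsIntegralSolutionOn.eqOn_forcedSolution (hF : LipschitzWith K F) (hg : Continuous g)
    {z : ℝ → E} {T : ℝ} (hz : IsIntegralSolutionOn F g z T) (hzc : Continuous z) :
    EqOn z (forcedSolution F g) (Icc 0 T) :=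
  hz.eqOn_of_lipschitzOnWith hF.lipschitzOnWith (isIntegralSolutionOn_forcedSolution hF hg T) hzc
    (continuous_forcedSolution hF hg) (fun _ _ => mem_univ _) fun _ _ => mem_univ _

/-- **Continuous dependence of the Picard solution on the forcing**:
`‖z_{g₁}(t) - z_{g₂}(t)‖ ≤ (sup_{[0,T]} ‖g₁ - g₂‖) e^{Kt}` on `[0, T]`. [folklore] -/
theorem norm_forcedSolution_sub_le (hF : LipschitzWith K F) {g₁ g₂ : ℝ → E} (hg₁ : Continuous g₁)
    (hg₂ : Continuous g₂) {T δ : ℝ} (hδ : ∀ t ∈ Icc 0 T, ‖g₁ t - g₂ t‖ ≤ δ) :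
    ∀ t ∈ Icc 0 T, ‖forcedSolution F g₁ t - forcedSolution F g₂ t‖ ≤ δ * Real.exp (K * t) :=
  IsIntegralSolutionOn.norm_sub_le_mul_exp hF.lipschitzOnWith
    (isIntegralSolutionOn_forcedSolution hF hg₁ T) (isIntegralSolutionOn_forcedSolution hF hg₂ T)
    (continuous_forcedSolution hF hg₁) (continuous_forcedSolution hF hg₂) (fun _ _ => mem_univ _)
    (fun _ _ => mem_univ _) hδ

/-- **The cocycle (flow) property of the Picard solution**: for `s, t ≥ 0`,
`z_g(s + t) = z_{g'}(t)` with the shifted forcing `g'(r) = z_g(s) + (g(s + r) - g(s))`. This is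
the pathwise identity behind the Markov property of SDEs with additive noise. [folklore] -/
theorem forcedSolution_add (hF : LipschitzWith K F) (hg : Continuous g) {s t : ℝ} (hs : 0 ≤ s)
    (ht : 0 ≤ t) :
    forcedSolution F g (s + t) =
      forcedSolution F (fun r => forcedSolution F g s + (g (s + r) - g s)) t := by
  have hzc := continuous_forcedSolution hF hg
  have hg' : Continuous fun r => forcedSolution F g s + (g (s + r) - g s) :=
    continuous_const.add ((hg.comp (continuous_const_add s)).sub continuous_const)
  have hsol : IsIntegralSolutionOn F (fun r => forcedSolution F g s + (g (s + r) - g s))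
      (fun r => forcedSolution F g (s + r)) (s + t - s) :=
    (isIntegralSolutionOn_forcedSolution hF hg (s + t)).shift
      ((hF.continuous.comp hzc).continuousOn) ⟨hs, le_add_of_nonneg_right ht⟩
  rw [add_sub_cancel_left] at hsol
  exact hsol.eqOn_forcedSolution hF hg' (hzc.comp (continuous_const_add s)) ⟨ht, le_rfl⟩

end SolutionProps

/-! ### Measurable dependence on a parameter -/

section Measurable

variable {Ω : Type*} {mΩ : MeasurableSpace Ω} {F : E → E} {K : ℝ≥0} {G : Ω → ℝ → E}

/-- The Picard iterates depend measurably on a measurably parametrised continuous forcing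
(induction: the time integral of a jointly measurable integrand is measurable in the parameter,
and joint measurability follows from continuity in time). The σ-algebra on the parameter space is
an implicit argument `{mΩ}` (so that sub-σ-algebras, e.g. the past of a driving noise, can be
used). [folklore] -/
theorem stronglyMeasurable_forcedPicard (hF : Continuous F) (hGc : ∀ ω, Continuous (G ω))
    (hGm : ∀ t, StronglyMeasurable fun ω => G ω t) :
    ∀ (n : ℕ) (t : ℝ), StronglyMeasurable fun ω => forcedPicard F (G ω) n t
  | 0 => hGm
  | n + 1 => by
    intro t
    have ih := stronglyMeasurable_forcedPicard hF hGc hGm n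
    have hj : StronglyMeasurable fun p : Ω × ℝ => F (forcedPicard F (G p.1) n p.2) := by
      have h1 : StronglyMeasurable (Function.uncurry fun (s : ℝ) (ω : Ω) => forcedPicard F (G ω) n s) :=
        stronglyMeasurable_uncurry_of_continuous_of_stronglyMeasurable
          (fun ω => continuous_forcedPicard hF (hGc ω) n) ih
      exact hF.comp_stronglyMeasurable (h1.comp_measurable measurable_swap)
    have hI : ∀ a b : ℝ, StronglyMeasurable fun ω => ∫ s in Ioc a b, F (forcedPicard F (G ω) n s) :=
      fun a b => hj.integral_prod_right' (ν := volume.restrict (Ioc a b))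
    have heq : (fun ω => forcedPicard F (G ω) (n + 1) t) = fun ω => G ω t +
        ((∫ s in Ioc 0 t, F (forcedPicard F (G ω) n s)) - ∫ s in Ioc t 0, F (forcedPicard F (G ω) n s)) := by
      funext ω
      rw [forcedPicard_succ, intervalIntegral]
    rw [heq]
    exact (hGm t).add ((hI 0 t).sub (hI t 0))

variable [CompleteSpace E]

/-- **The Picard solution depends measurably on the parameter** of a measurably parametrised
continuous forcing (pointwise limit of the measurable iterates). [folklore] -/
theorem stronglyMeasurable_forcedSolution (hF : LipschitzWith K F) (hGc : ∀ ω, Continuous (G ω))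
    (hGm : ∀ t, StronglyMeasurable fun ω => G ω t) (t : ℝ) :
    StronglyMeasurable fun ω => forcedSolution F (G ω) t := by
  refine stronglyMeasurable_of_tendsto atTop (f := fun n ω => forcedPicard F (G ω) n (max t 0))
    (fun n => stronglyMeasurable_forcedPicard hF.continuous hGc hGm n _) ?_
  rw [tendsto_pi_nhds]
  intro ω
  rw [forcedSolution_eq_max]
  exact tendsto_forcedPicard hF (hGc ω) (le_max_right t 0)

/-- Joint measurability of `(ω, t) ↦ z_{G ω}(t)` (measurable in `ω`, continuous in `t`).
[folklore] -/
theorem stronglyMeasurable_uncurry_forcedSolution (hF : LipschitzWith K F)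
    (hGc : ∀ ω, Continuous (G ω)) (hGm : ∀ t, StronglyMeasurable fun ω => G ω t) :
    StronglyMeasurable fun p : Ω × ℝ => forcedSolution F (G p.1) p.2 :=
  (stronglyMeasurable_uncurry_of_continuous_of_stronglyMeasurable
    (u := fun (t : ℝ) (ω : Ω) => forcedSolution F (G ω) t)
    (fun ω => continuous_forcedSolution hF (hGc ω))
    (stronglyMeasurable_forcedSolution hF hGc hGm)).comp_measurable measurable_swap

end Measurable

end Literature.Analysis.ODE
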